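import Mathlib
import Literature.NumberTheory.Automorphic.HigherGreenFunctionProofs

/-!
# Higher Green functions, layer 0 (continued): arithmetic of the CM arguments

Fourth proved companion file of `Literature/NumberTheory/Automorphic/HigherGreenFunction.lean`
(the Gross–Zagier algebraicity conjecture `GKZAlgebraicity`, Bruinier–Li–Yang 2025,
Conjecture 1.1 / Theorem 1.4), after `HigherGreenFunctionProofs.lean` (convergence, invariance,
Hecke structure), `HigherGreenFunctionProofs2.lean` (Legendre's equation, `q`-expansions) and
`HigherGreenFunctionProofs3.lean` (the Laplace eigen-equation of the series). This file treats the
elementary arithmetic of the points at which Conjecture 1.1 evaluates `G_{r+1,f}`: CM points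
`zⱼ` of discriminants `dⱼ` (`IsCMPointOfDisc`), and what it implies for the individual terms
`Q_{s-1}(cosh d(z₁, γz₂))`, `γ ∈ R_N^{(m)}`, of (1.1)–(1.2) and for the hypothesis
`(z₁, z₂) ∉ Z_f`.

* `re_im_of_quadratic`, `re_eq_of_quadratic`, `two_mul_im_eq_sqrt_of_quadratic`,
  `disc_neg_of_quadratic`: a root `z ∈ ℍ` of an integral `a z² + b z + c = 0`, `a > 0`, is
  `z = (-b + i√(4ac - b²))/(2a)`, and `b² - 4ac < 0`.
* `cosh_dist_mul_sqrt_eq_of_quadratic`: **for two such roots,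
  `cosh d(z₁, z₂) · √(Δ₁Δ₂) = 2(a₁c₂ + a₂c₁) - b₁b₂ =: n ∈ ℤ`** (`Δⱼ = bⱼ² - 4aⱼcⱼ`), with
  `n² ≡ Δ₁Δ₂ (mod 4)` (`four_dvd_sq_sub_disc_mul_disc`); hence
  `IsCMPointOfDisc.exists_int_eq_cosh_dist`: `cosh d(z₁, z₂) √(d₁d₂) = n ∈ ℤ`, `n² ≡ d₁d₂ (mod 4)`,
  for CM points.
* `exists_quadratic_intGL_smul`: a Hecke translate `γz`, `γ ∈ R_N^{(m)}`, `m ≥ 1`, of a root of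
  the form `(a, b, c)` is a root of the integral form `(a, b, c) ∘ adj(γ)` of discriminant
  `m²(b² - 4ac)`; hence `IsCMPointOfDisc.exists_int_eq_cosh_dist_smul`: **every argument of
  `Q_{s-1}` in `G_s^{Γ₀(N),m}(z₁, z₂)` at CM points is `n/(m√(d₁d₂))` with `n ∈ ℤ`,
  `n² ≡ m²d₁d₂ (mod 4)`** — the natural irrationality `√(d₁d₂)` behind the factor `|d₁d₂|^{-r/2}`
  of Conjecture 1.1 — and
  `IsCMPointOfDisc.higherGreen_eq_tsum_card_mul_greenQ`: **the representation-number form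
  `G_s^{Γ₀(N),m}(z₁, z₂) = -2 Σ_{n ∈ ℤ} ρ(n) Q_{s-1}(n/(m√(d₁d₂)))`**,
  `ρ(n) = #{γ ∈ R_N^{(m)} : m cosh d(z₁, γz₂) √(d₁d₂) = n}` (regrouping the absolutely convergent
  series (1.1)–(1.2) along its fibres; the fibres are finite, `finite_fiber_cosh_dist_smul`,
  `finite_setOf_cosh_dist_smul_le`, and empty for `n < m√(d₁d₂)`, resp. `n ≤ m√(d₁d₂)` off `T_m`:
  `card_fiber_cosh_dist_smul_eq_zero`, `card_fiber_cosh_dist_smul_eq_zero_of_le`).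
* `exists_eq_mul_of_quadratic_of_primitive`, `IsCMPointOfDisc.exists_disc_eq_sq_mul`: every
  integral quadratic equation of a CM point is an integral multiple of the primitive one (Bézout),
  so its discriminant is `e²d`; hence `isSquare_mul_disc_of_onHeckeCorrespondence`: **if
  `(z₁, z₂) ∈ T_m` for some `m ≥ 1` then `d₁d₂` is a perfect square** (`ℚ(z₁) = ℚ(z₂)`), i.e.
  `not_onHeckeCorrespondence_of_not_isSquare`: CM points with `d₁d₂` not a square lie on no Hecke
  correspondence. This is the case distinction of the proof of Theorem 1.4 on p. 3 of the paper
  (`d₁d₂` not a square: Theorem 1.2 + Li 2021; `d₁d₂` a square, "`E₁ = E₂`":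
  Bruinier–Ehlen–Yang 2021), and `GKZAlgebraicity.of_not_isSquare` records that **in the setting
  of Theorem 1.2 the hypothesis `(z₁, z₂) ∉ Z_f` of Conjecture 1.1 is automatic**. Conversely
  (`IsCMPointOfDisc.exists_onHeckeCorrespondence_of_isSquare`, `_iff_isSquare`): **if `d₁d₂` is a
  perfect square then `z₁ = γz₂` for an explicit upper triangular integer `γ` of positive
  determinant, so `(z₁, z₂)` lies on some `T_m` (any level); `(z₁, z₂) ∈ ⋃_{m ≥ 1} T_m ⇔ d₁d₂` is
  a square.**
* `IsCMPointOfDisc.exists_reduced_of_mem_fd`: a CM point of discriminant `d` in the standard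
  fundamental domain `𝒟` of `SL(2, ℤ)` is the root of a *reduced* form, `|b| ≤ a ≤ c`, so
  `3a² ≤ |d|`; hence `exists_finset_isCMPointOfDisc_mem_fd`, `finite_setOf_isCMPointOfDisc_mem_fd`,
  `exists_finset_isCMPointOfDisc_smul_mem`, `exists_finite_isCMPointOfDisc_gamma0_smul_mem`:
  **the CM points of discriminant `d` are finite in number modulo `SL(2, ℤ)` and modulo every
  `Γ₀(N)`** (Mathlib's `ModularGroup.exists_smul_mem_fd` and the finite index of `Γ₀(N)`), so for
  fixed `(N, r, f, d₁, d₂)` Conjecture 1.1 concerns finitely many values `G_{r+1,f}(z₁, z₂)`.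
* `onHeckeCorrespondence_self_iff`, `IsCMPointOfDisc.onHeckeCorrespondence_self_iff_levelOne`:
  **the diagonal** — a root `z` of the primitive form `(a, b, c)` is fixed by `γ ∈ R_N^{(m)}` iff
  `γ = p·1 + e·(0, -c; a, b)` with `p² + bpe + ace² = m`, `N ∣ ae`; so `(z, z) ∈ T_m` iff `m` is
  so represented (a norm from the order of discriminant `b² - 4ac`), which identifies the diagonal
  CM values excluded by the hypothesis `(z₁, z₂) ∉ Z_f` of Conjecture 1.1.
* `principalHigherGreen_add`, `principalHigherGreen_smul`, `gkz_conclusion_add`,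
  `gkz_conclusion_smul` (`exists_isAlgebraic_log_norm_add`): `G_{r+1,f}` is `ℚ`-linear in `f`
  and the conclusion `∃ α ∈ ℚ̄ˣ, G_{r+1,f}(z₁, z₂) = |d₁d₂|^{-r/2} log|α|` is stable under sums and
  rational multiples of `f`, so it suffices to know Conjecture 1.1 on a `ℚ`-spanning family of
  `M^{!,∞}_{-2r}(Γ₀(N))`.

## References

* J. H. Bruinier, Y. Li, T. Yang, *Deformations of theta integrals and a conjecture of
  Gross–Zagier*, Forum Math. Sigma 13 (2025), arXiv:2204.10604: Conjecture 1.1, Theorems 1.2 and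
  1.4, (1.1)–(1.3), and the case distinction `E₁ ≠ E₂` / `E₁ = E₂` on p. 3. [`BruinierLiYang2025`]
* B. Gross, D. Zagier, *Heegner points and derivatives of L-series*, Invent. Math. 84 (1986),
  §II.2 and §V.4. [`GrossZagier1986`]
-/

noncomputable section

namespace Literature.NumberTheory.Automorphic

open UpperHalfPlane Complex CongruenceSubgroup Real Set Filter
open scoped MatrixGroups ModularForm Manifold Real

open Literature.NumberTheory.EllipticCurves.ModularForms (intGL intGL_apply coe_intGL)

/-! ## Roots in `ℍ` of integral quadratic equations -/

/-- If `z ∈ ℍ` is a root of `a z² + b z + c = 0` (`a, b, c ∈ ℤ`), then `2a Re z + b = 0` and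
`4a² (Im z)² = -(b² - 4ac)` (real and imaginary parts). [folklore] -/
theorem re_im_of_quadratic {z : ℍ} {a b c : ℤ}
    (hz : (a : ℂ) * (z : ℂ) ^ 2 + b * (z : ℂ) + c = 0) :
    2 * (a : ℝ) * z.re + b = 0 ∧ 4 * (a : ℝ) ^ 2 * z.im ^ 2 = -((b : ℝ) ^ 2 - 4 * a * c) := by
  have hx2 : ((z : ℂ) ^ 2).re = z.re ^ 2 - z.im ^ 2 := by
    rw [sq, Complex.mul_re, UpperHalfPlane.coe_re, UpperHalfPlane.coe_im]; ring
  have hy2 : ((z : ℂ) ^ 2).im = 2 * z.re * z.im := by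
    rw [sq, Complex.mul_im, UpperHalfPlane.coe_re, UpperHalfPlane.coe_im]; ring
  have hre := congrArg Complex.re hz
  have him := congrArg Complex.im hz
  simp only [Complex.add_re, Complex.mul_re, Complex.intCast_re, Complex.intCast_im, zero_mul,
    sub_zero, Complex.add_im, Complex.mul_im, add_zero, Complex.zero_re, Complex.zero_im, hx2, hy2,
    UpperHalfPlane.coe_re, UpperHalfPlane.coe_im] at hre him
  have hy : 0 < z.im := z.im_pos
  have h1 : (2 * (a : ℝ) * z.re + b) * z.im = 0 := by linear_combination him
  have h2 : 2 * (a : ℝ) * z.re + b = 0 := (mul_eq_zero.mp h1).resolve_right hy.ne'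
  exact ⟨h2, by linear_combination (-4 * (a : ℝ)) * hre + (2 * (a : ℝ) * z.re + b) * h2⟩

/-- The discriminant of an integral quadratic equation with a root in `ℍ` and `a ≠ 0` is negative:
`b² - 4ac = -4a²(Im z)² < 0`. [folklore] -/
theorem disc_neg_of_quadratic {z : ℍ} {a b c : ℤ} (ha : a ≠ 0)
    (hz : (a : ℂ) * (z : ℂ) ^ 2 + b * (z : ℂ) + c = 0) : b ^ 2 - 4 * a * c < 0 := by
  obtain ⟨-, h⟩ := re_im_of_quadratic hz
  have hy : 0 < z.im := z.im_pos
  have ha' : (0 : ℝ) < (a : ℝ) ^ 2 := by positivity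
  have : (0 : ℝ) < 4 * (a : ℝ) ^ 2 * z.im ^ 2 := by positivity
  have h' : ((b ^ 2 - 4 * a * c : ℤ) : ℝ) < 0 := by push_cast; linarith
  exact_mod_cast h'

/-- For a root `z ∈ ℍ` of `a z² + b z + c = 0` with `a ≠ 0`: `Re z = -b/(2a)`. [folklore] -/
theorem re_eq_of_quadratic {z : ℍ} {a b c : ℤ} (ha : a ≠ 0)
    (hz : (a : ℂ) * (z : ℂ) ^ 2 + b * (z : ℂ) + c = 0) : z.re = -(b : ℝ) / (2 * a) := by
  obtain ⟨h, -⟩ := re_im_of_quadratic hz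
  have ha' : (a : ℝ) ≠ 0 := by exact_mod_cast ha
  field_simp
  linear_combination h

/-- For a root `z ∈ ℍ` of `a z² + b z + c = 0` with `a > 0`: `2a Im z = √(4ac - b²)`, i.e.
`z = (-b + i√|b² - 4ac|)/(2a)`. [folklore] -/
theorem two_mul_im_eq_sqrt_of_quadratic {z : ℍ} {a b c : ℤ} (ha : 0 < a)
    (hz : (a : ℂ) * (z : ℂ) ^ 2 + b * (z : ℂ) + c = 0) :
    2 * (a : ℝ) * z.im = Real.sqrt (-((b : ℝ) ^ 2 - 4 * a * c)) := by
  obtain ⟨-, h⟩ := re_im_of_quadratic hz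
  have hpos : 0 ≤ 2 * (a : ℝ) * z.im := by
    have := z.im_pos
    positivity
  rw [← h, show 4 * (a : ℝ) ^ 2 * z.im ^ 2 = (2 * a * z.im) ^ 2 by ring, Real.sqrt_sq hpos]

/-! ## `cosh d(z₁, z₂) · √(d₁d₂)` is an integer for CM points -/

/-- **The hyperbolic cosine of the distance of two quadratic irrationalities.** If `zⱼ ∈ ℍ` is a
root of `aⱼ z² + bⱼ z + cⱼ = 0` (`aⱼ > 0`, integral coefficients, discriminants
`Δⱼ = bⱼ² - 4aⱼcⱼ < 0`), then
`cosh d(z₁, z₂) · √(Δ₁Δ₂) = 2(a₁c₂ + a₂c₁) - b₁b₂`,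
an integer: with `zⱼ = (-bⱼ + i√|Δⱼ|)/(2aⱼ)` one has
`cosh d = ((x₁-x₂)² + y₁² + y₂²)/(2y₁y₂)` and `2y₁y₂ = √(Δ₁Δ₂)/(2a₁a₂)`. So the arguments
`t = cosh d(z₁, γz₂)` at which `Q_{s-1}` is evaluated in `G_s^{Γ₀(N),m}(z₁, z₂)` ((1.1)–(1.2) of
Bruinier–Li–Yang 2025) lie in `(m√(d₁d₂))⁻¹ ℤ` for CM points — the source of the factor
`|d₁d₂|^{-r/2}` in Conjecture 1.1 (`.exists_int_eq_cosh_dist_smul` below). [folklore] -/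
theorem cosh_dist_mul_sqrt_eq_of_quadratic {z₁ z₂ : ℍ} {a₁ b₁ c₁ a₂ b₂ c₂ : ℤ}
    (ha₁ : 0 < a₁) (ha₂ : 0 < a₂)
    (hz₁ : (a₁ : ℂ) * (z₁ : ℂ) ^ 2 + b₁ * (z₁ : ℂ) + c₁ = 0)
    (hz₂ : (a₂ : ℂ) * (z₂ : ℂ) ^ 2 + b₂ * (z₂ : ℂ) + c₂ = 0) :
    Real.cosh (dist z₁ z₂) *
        Real.sqrt ((((b₁ ^ 2 - 4 * a₁ * c₁) * (b₂ ^ 2 - 4 * a₂ * c₂) : ℤ) : ℝ)) =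
      ((2 * (a₁ * c₂ + a₂ * c₁) - b₁ * b₂ : ℤ) : ℝ) := by
  obtain ⟨hx₁, hy₁⟩ := re_im_of_quadratic hz₁
  obtain ⟨hx₂, hy₂⟩ := re_im_of_quadratic hz₂
  have hy1 := z₁.im_pos
  have hy2 := z₂.im_pos
  have hprod : (((b₁ ^ 2 - 4 * a₁ * c₁) * (b₂ ^ 2 - 4 * a₂ * c₂) : ℤ) : ℝ) =
      (4 * a₁ * a₂ * z₁.im * z₂.im) ^ 2 := by
    push_cast
    linear_combination (-(4 * (a₂ : ℝ) ^ 2 * z₂.im ^ 2)) * hy₁ + ((b₁ : ℝ) ^ 2 - 4 * a₁ * c₁) * hy₂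
  have hpos : 0 ≤ 4 * (a₁ : ℝ) * a₂ * z₁.im * z₂.im := by positivity
  have h2a : (2 * (a₁ : ℝ) * a₂) ≠ 0 := by positivity
  -- `2a₁a₂ ((x₁-x₂)² + y₁² + y₂²) = 2(a₁c₂ + a₂c₁) - b₁b₂`
  have hT : 2 * (a₁ : ℝ) * a₂ * ((z₁.re - z₂.re) ^ 2 + z₁.im ^ 2 + z₂.im ^ 2) =
      ((2 * (a₁ * c₂ + a₂ * c₁) - b₁ * b₂ : ℤ) : ℝ) := by
    apply mul_left_cancel₀ h2a
    push_cast
    linear_combination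
      ((a₂ : ℝ) * (2 * a₁ * a₂ * z₁.re - 2 * a₁ * a₂ * z₂.re - a₂ * b₁ + a₁ * b₂)) * hx₁ -
      ((a₁ : ℝ) * (2 * a₁ * a₂ * z₁.re - 2 * a₁ * a₂ * z₂.re - a₂ * b₁ + a₁ * b₂)) * hx₂ +
      (a₂ : ℝ) ^ 2 * hy₁ + (a₁ : ℝ) ^ 2 * hy₂
  rw [hprod, Real.sqrt_sq hpos, UpperHalfPlane.cosh_dist, coshDistArg_eq, ← hT]
  field_simp
  ring

/-- The integer `n = 2(a₁c₂ + a₂c₁) - b₁b₂` of `cosh_dist_mul_sqrt_eq_of_quadratic` satisfies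
`n² ≡ Δ₁Δ₂ (mod 4)`: `n² - Δ₁Δ₂ = 4((a₁c₂ - a₂c₁)² + (a₂b₁ - a₁b₂)(c₂b₁ - c₁b₂))`. [folklore] -/
theorem four_dvd_sq_sub_disc_mul_disc (a₁ b₁ c₁ a₂ b₂ c₂ : ℤ) :
    (4 : ℤ) ∣ (2 * (a₁ * c₂ + a₂ * c₁) - b₁ * b₂) ^ 2 - (b₁ ^ 2 - 4 * a₁ * c₁) * (b₂ ^ 2 - 4 * a₂ * c₂) :=
  ⟨(a₁ * c₂ - a₂ * c₁) ^ 2 + (a₂ * b₁ - a₁ * b₂) * (c₂ * b₁ - c₁ * b₂), by ring⟩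

/-! ## Transport of quadratic equations along `R_N^{(m)}` -/

/-- **A Hecke translate of a quadratic irrationality.** If `z ∈ ℍ` is a root of
`a z² + b z + c = 0` (`a > 0`, integral) and `γ = (p q; r t) ∈ R_N^{(m)}`, `m > 0`, then `γ z` is a
root of the integral equation `a' w² + b' w + c' = 0` with
`(a', b', c') = (a t² - b t r + c r², -2atq + b(tp + qr) - 2crp, a q² - b q p + c p²)` — the form
`(a, b, c) ∘ adj(γ)` — which has `a' > 0` and discriminant `b'² - 4a'c' = m² (b² - 4ac)`
(not necessarily primitive). [folklore] -/
theorem exists_quadratic_intGL_smul {N : ℕ} {m : ℤ} (hm : 0 < m) {γ : Matrix (Fin 2) (Fin 2) ℤ}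
    (hγ : γ ∈ heckeMatrices N m) {z : ℍ} {a b c : ℤ} (ha : 0 < a)
    (hz : (a : ℂ) * (z : ℂ) ^ 2 + b * (z : ℂ) + c = 0) :
    ∃ a' b' c' : ℤ, 0 < a' ∧
      (a' : ℂ) * ((intGL γ • z : ℍ) : ℂ) ^ 2 + b' * ((intGL γ • z : ℍ) : ℂ) + c' = 0 ∧
      b' ^ 2 - 4 * a' * c' = m ^ 2 * (b ^ 2 - 4 * a * c) := by
  have hdisc : b ^ 2 - 4 * a * c < 0 := disc_neg_of_quadratic ha.ne' hz
  -- entries of `γ`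
  set p : ℤ := γ 0 0 with hp
  set q : ℤ := γ 0 1 with hq
  set r : ℤ := γ 1 0 with hr
  set t : ℤ := γ 1 1 with ht
  have hdet : p * t - q * r = m := by
    have h1 := (mem_heckeMatrices.mp hγ).1
    rw [Matrix.det_fin_two] at h1
    rw [hp, ht, hq, hr]
    linear_combination h1
  -- the transformed form
  set a' : ℤ := a * t ^ 2 - b * t * r + c * r ^ 2 with ha'
  set b' : ℤ := -2 * a * t * q + b * (t * p + q * r) - 2 * c * r * p with hb'
  set c' : ℤ := a * q ^ 2 - b * q * p + c * p ^ 2 with hc'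
  refine ⟨a', b', c', ?_, ?_, ?_⟩
  · -- positivity of `a' = a t² - b t r + c r²`: `4 a a' = (2at - br)² - (b² - 4ac) r²`
    by_cases hr0 : r = 0
    · have hpt : p * t = m := by rw [hr0, mul_zero, sub_zero] at hdet; exact hdet
      have ht0 : t ≠ 0 := by
        rintro h0
        rw [h0, mul_zero] at hpt
        exact hm.ne' hpt.symm
      have : 0 < t ^ 2 := by positivity
      rw [ha', hr0]
      nlinarith
    · have hr2 : 0 < r ^ 2 := by positivity
      have key : 4 * a * a' = (2 * a * t - b * r) ^ 2 + (4 * a * c - b ^ 2) * r ^ 2 := by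
        rw [ha']
        ring
      nlinarith [sq_nonneg (2 * a * t - b * r), mul_pos (by linarith : 0 < 4 * a * c - b ^ 2) hr2]
  · -- `γ z` is a root of the transformed form
    have hw : ((intGL γ • z : ℍ) : ℂ) = ((p : ℂ) * z + q) / ((r : ℂ) * z + t) := by
      rw [coe_intGL_smul hm hγ]
    have hden : (r : ℂ) * z + t ≠ 0 :=
      linear_ne_zero_of_det_ne_zero (γ := γ) (det_ne_zero_of_mem_heckeMatrices hm.ne' hγ) z
    have key : ((a' : ℂ) * (((p : ℂ) * z + q) / ((r : ℂ) * z + t)) ^ 2 +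
        b' * (((p : ℂ) * z + q) / ((r : ℂ) * z + t)) + c') * ((r : ℂ) * z + t) ^ 2 = 0 := by
      rw [ha', hb', hc']
      push_cast
      field_simp
      linear_combination ((p : ℂ) * t - q * r) ^ 2 * hz
    rw [hw]
    exact (mul_eq_zero.mp key).resolve_right (pow_ne_zero 2 hden)
  · -- the discriminant is multiplied by `det² = m²`
    rw [← hdet, ha', hb', hc']
    ring

/-- **Every integral quadratic equation of a CM point is a multiple of the primitive one.** If
`z ∈ ℍ` is a root of the primitive form `(a, b, c)` (`a ≠ 0`, `gcd(a, b, c) = 1`) and also of the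
integral form `(a', b', c')`, then `(a', b', c') = e (a, b, c)` for some `e ∈ ℤ`: comparing
`a (a'z² + b'z + c') - a' (az² + bz + c) = (ab' - a'b) z + (ac' - a'c) = 0` with `z ∉ ℝ` gives
`ab' = a'b`, `ac' = a'c`, and Bézout `ua + vb + wc = 1` gives `a' = a (ua' + vb' + wc')`.
[folklore] -/
theorem exists_eq_mul_of_quadratic_of_primitive {z : ℍ} {a b c a' b' c' : ℤ} (ha : a ≠ 0)
    (hgcd : Int.gcd (Int.gcd a b) c = 1)
    (hz : (a : ℂ) * (z : ℂ) ^ 2 + b * (z : ℂ) + c = 0)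
    (hz' : (a' : ℂ) * (z : ℂ) ^ 2 + b' * (z : ℂ) + c' = 0) :
    ∃ e : ℤ, a' = e * a ∧ b' = e * b ∧ c' = e * c := by
  have hy : 0 < z.im := z.im_pos
  have key : ((a * b' - a' * b : ℤ) : ℂ) * (z : ℂ) + ((a * c' - a' * c : ℤ) : ℂ) = 0 := by
    push_cast
    linear_combination (a : ℂ) * hz' - (a' : ℂ) * hz
  have him := congrArg Complex.im key
  simp only [Complex.add_im, Complex.mul_im, Complex.intCast_re, Complex.intCast_im, zero_mul,
    add_zero, Complex.zero_im, UpperHalfPlane.coe_im] at him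
  have hab : ((a * b' - a' * b : ℤ) : ℝ) = 0 := (mul_eq_zero.mp him).resolve_right hy.ne'
  have hre := congrArg Complex.re key
  simp only [Complex.add_re, Complex.mul_re, Complex.intCast_re, Complex.intCast_im, zero_mul,
    sub_zero, Complex.zero_re, UpperHalfPlane.coe_re, hab, zero_add] at hre
  have hab' : a * b' = a' * b := by
    have : (a * b' - a' * b : ℤ) = 0 := by exact_mod_cast hab
    linarith
  have hac' : a * c' = a' * c := by
    have : (a * c' - a' * c : ℤ) = 0 := by exact_mod_cast hre
    linarith
  -- Bézout for `gcd(gcd(a, b), c) = 1`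
  have h1 : ((Int.gcd a b : ℕ) : ℤ) = a * Int.gcdA a b + b * Int.gcdB a b := Int.gcd_eq_gcd_ab a b
  have h2 : ((Int.gcd (Int.gcd a b : ℤ) c : ℕ) : ℤ) =
      (Int.gcd a b : ℤ) * Int.gcdA (Int.gcd a b : ℤ) c + c * Int.gcdB (Int.gcd a b : ℤ) c :=
    Int.gcd_eq_gcd_ab _ c
  rw [hgcd, Nat.cast_one, h1] at h2
  set A := Int.gcdA a b
  set B := Int.gcdB a b
  set A' := Int.gcdA (a * A + b * B) c
  set B' := Int.gcdB (a * A + b * B) c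
  -- `1 = a (A A') + b (B A') + c B'`
  refine ⟨a' * (A * A') + b' * (B * A') + c' * B', ?_, ?_, ?_⟩
  · linear_combination a' * h2 + (-(B * A')) * hab' - B' * hac'
  · -- `a b' = a' b = e a b`, cancel `a`
    apply mul_left_cancel₀ ha
    linear_combination (1 - b * (B * A')) * hab' + a' * b * h2 - b * B' * hac'
  · apply mul_left_cancel₀ ha
    linear_combination (1 - c * B') * hac' + a' * c * h2 - c * (B * A') * hab'

/-- **The discriminant of any integral quadratic equation of a CM point of discriminant `d` is
`e² d`.** [folklore] -/
theorem IsCMPointOfDisc.exists_disc_eq_sq_mul {z : ℍ} {d : ℤ} (h : IsCMPointOfDisc z d)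
    {a' b' c' : ℤ} (hz' : (a' : ℂ) * (z : ℂ) ^ 2 + b' * (z : ℂ) + c' = 0) :
    ∃ e : ℤ, b' ^ 2 - 4 * a' * c' = e ^ 2 * d := by
  obtain ⟨a, b, c, ha, hgcd, hz, rfl⟩ := h
  obtain ⟨e, rfl, rfl, rfl⟩ := exists_eq_mul_of_quadratic_of_primitive ha.ne' hgcd hz hz'
  exact ⟨e, by ring⟩

/-- The product of the discriminants of two CM points is positive. [folklore] -/
theorem IsCMPointOfDisc.mul_disc_pos {z₁ z₂ : ℍ} {d₁ d₂ : ℤ} (h₁ : IsCMPointOfDisc z₁ d₁)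
    (h₂ : IsCMPointOfDisc z₂ d₂) : 0 < d₁ * d₂ :=
  mul_pos_of_neg_of_neg h₁.disc_neg h₂.disc_neg

/-- **`cosh d(z₁, z₂) √(d₁d₂)` is an integer `n` with `n² ≡ d₁d₂ (mod 4)` for CM points `zⱼ` of
discriminants `dⱼ`.** [folklore] -/
theorem IsCMPointOfDisc.exists_int_eq_cosh_dist {z₁ z₂ : ℍ} {d₁ d₂ : ℤ}
    (h₁ : IsCMPointOfDisc z₁ d₁) (h₂ : IsCMPointOfDisc z₂ d₂) :
    ∃ n : ℤ, Real.cosh (dist z₁ z₂) * Real.sqrt ((d₁ * d₂ : ℤ) : ℝ) = n ∧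
      (4 : ℤ) ∣ n ^ 2 - d₁ * d₂ := by
  obtain ⟨a₁, b₁, c₁, ha₁, -, hz₁, rfl⟩ := h₁
  obtain ⟨a₂, b₂, c₂, ha₂, -, hz₂, rfl⟩ := h₂
  exact ⟨_, cosh_dist_mul_sqrt_eq_of_quadratic ha₁ ha₂ hz₁ hz₂,
    four_dvd_sq_sub_disc_mul_disc a₁ b₁ c₁ a₂ b₂ c₂⟩

/-- **The arguments of `Q_{s-1}` in `G_s^{Γ₀(N),m}(z₁, z₂)` at CM points:
`m cosh d(z₁, γz₂) √(d₁d₂) ∈ ℤ` for every `γ ∈ R_N^{(m)}`, `m > 0`** (`γz₂` satisfies an integral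
quadratic equation of discriminant `m²d₂`). Hence every term of (1.1)–(1.2) of
Bruinier–Li–Yang 2025 at a CM point is `Q_{s-1}(n/(m√(d₁d₂)))` with `n ∈ ℤ`,
`n² ≡ m²d₁d₂ (mod 4)`, and `n > m√(d₁d₂)` off `T_m`. [folklore] -/
theorem IsCMPointOfDisc.exists_int_eq_cosh_dist_smul {N : ℕ} {m : ℤ} (hm : 0 < m)
    {γ : Matrix (Fin 2) (Fin 2) ℤ} (hγ : γ ∈ heckeMatrices N m) {z₁ z₂ : ℍ} {d₁ d₂ : ℤ}
    (h₁ : IsCMPointOfDisc z₁ d₁) (h₂ : IsCMPointOfDisc z₂ d₂) :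
    ∃ n : ℤ, (m : ℝ) * (Real.cosh (dist z₁ (intGL γ • z₂)) * Real.sqrt ((d₁ * d₂ : ℤ) : ℝ)) = n ∧
      (4 : ℤ) ∣ n ^ 2 - m ^ 2 * (d₁ * d₂) := by
  obtain ⟨a₁, b₁, c₁, ha₁, -, hz₁, rfl⟩ := h₁
  obtain ⟨a₂, b₂, c₂, ha₂, -, hz₂, rfl⟩ := h₂
  obtain ⟨a', b', c', ha', hw, hdisc⟩ := exists_quadratic_intGL_smul hm hγ ha₂ hz₂
  refine ⟨2 * (a₁ * c' + a' * c₁) - b₁ * b', ?_, ?_⟩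
  · rw [← cosh_dist_mul_sqrt_eq_of_quadratic ha₁ ha' hz₁ hw, hdisc]
    have hm0 : (0 : ℝ) ≤ m := by exact_mod_cast hm.le
    rw [show ((((b₁ ^ 2 - 4 * a₁ * c₁) * (m ^ 2 * (b₂ ^ 2 - 4 * a₂ * c₂))) : ℤ) : ℝ) =
        (m : ℝ) ^ 2 * (((b₁ ^ 2 - 4 * a₁ * c₁) * (b₂ ^ 2 - 4 * a₂ * c₂) : ℤ) : ℝ) by push_cast; ring,
      Real.sqrt_mul (sq_nonneg _), Real.sqrt_sq hm0]
    ring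
  · have h := four_dvd_sq_sub_disc_mul_disc a₁ b₁ c₁ a' b' c'
    rwa [hdisc, show (b₁ ^ 2 - 4 * a₁ * c₁) * (m ^ 2 * (b₂ ^ 2 - 4 * a₂ * c₂)) =
      m ^ 2 * ((b₁ ^ 2 - 4 * a₁ * c₁) * (b₂ ^ 2 - 4 * a₂ * c₂)) by ring] at h

/-! ## Points on a Hecke correspondence have `d₁d₂` a perfect square -/

/-- **If `(z₁, z₂) ∈ T_m` for some `m ≥ 1` then `d₁d₂` is a perfect square** (CM points
`zⱼ` of discriminants `dⱼ`): `z₁ = γz₂` satisfies an integral quadratic equation of discriminant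
`m²d₂`, which is `e²d₁` by primitivity, so `d₁d₂ = (ed₁/m)²`. Equivalently `ℚ(z₁) = ℚ(z₂)`; this is
the dichotomy "`d₁d₂` not a perfect square" (Theorem 1.2: then `(z₁, z₂)` lies on no Hecke
correspondence and the hypothesis `(z₁, z₂) ∉ Z_f` of Conjecture 1.1 is automatic,
`GKZAlgebraicity.of_not_isSquare`) versus "`E₁ = E₂`" (Bruinier–Ehlen–Yang) in the proof of
Theorem 1.4 of Bruinier–Li–Yang 2025 (p. 3). [cite: BruinierLiYang2025, p. 3 and Thm. 1.2] -/
theorem isSquare_mul_disc_of_onHeckeCorrespondence {N : ℕ} {m : ℤ} (hm : 0 < m) {z₁ z₂ : ℍ}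
    {d₁ d₂ : ℤ} (h₁ : IsCMPointOfDisc z₁ d₁) (h₂ : IsCMPointOfDisc z₂ d₂)
    (h : OnHeckeCorrespondence N m z₁ z₂) : IsSquare (d₁ * d₂) := by
  obtain ⟨γ, hγ, hγz⟩ := h
  obtain ⟨a, b, c, ha, -, hz, hd⟩ := h₂
  obtain ⟨a', b', c', -, hz', hdisc⟩ := exists_quadratic_intGL_smul hm hγ ha hz
  rw [hγz] at hz'
  obtain ⟨e, he⟩ := h₁.exists_disc_eq_sq_mul hz'
  have key : m ^ 2 * d₂ = e ^ 2 * d₁ := by rw [hd, ← hdisc, he]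
  have hdvd : m ^ 2 ∣ (e * d₁) ^ 2 := ⟨d₁ * d₂, by linear_combination (-d₁) * key⟩
  obtain ⟨k, hk⟩ := (Int.pow_dvd_pow_iff two_ne_zero).mp hdvd
  refine ⟨k, ?_⟩
  have hm2 : m ^ 2 ≠ 0 := pow_ne_zero 2 hm.ne'
  apply mul_left_cancel₀ hm2
  linear_combination d₁ * key + (e * d₁ + m * k) * hk

/-- Contrapositive: **CM points with `d₁d₂` not a perfect square lie on no Hecke correspondence
`T_m`, `m ≥ 1`.** [cite: BruinierLiYang2025, p. 3 and Thm. 1.2] -/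
theorem not_onHeckeCorrespondence_of_not_isSquare {N : ℕ} {m : ℤ} (hm : 0 < m) {z₁ z₂ : ℍ}
    {d₁ d₂ : ℤ} (h₁ : IsCMPointOfDisc z₁ d₁) (h₂ : IsCMPointOfDisc z₂ d₂)
    (hD : ¬ IsSquare (d₁ * d₂)) : ¬ OnHeckeCorrespondence N m z₁ z₂ :=
  fun h => hD (isSquare_mul_disc_of_onHeckeCorrespondence hm h₁ h₂ h)

/-- **Conjecture 1.1 in the setting of Theorem 1.2 of Bruinier–Li–Yang 2025 (`d₁d₂` not a
perfect square): no condition on `Z_f` is needed**, since `(z₁, z₂)` lies on no `T_m`. Under the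
named fact `GKZAlgebraicity`: for every `f ∈ M^{!,∞}_{-2r}(Γ₀(N))` with rational coefficients and
all CM points `z₁, z₂` with `d₁d₂` not a square, `G_{r+1,f}(z₁, z₂) = |d₁d₂|^{-r/2} log|α|` with
`α ∈ ℚ̄ˣ`. [cite: BruinierLiYang2025, Conj. 1.1, Thm. 1.2 and Thm. 1.4] -/
theorem GKZAlgebraicity.of_not_isSquare (h : GKZAlgebraicity) {N r : ℕ} (hN : 0 < N) (hr : 0 < r)
    {f : ℍ → ℂ} {c : ℤ → ℚ} (hf : IsRatWeaklyHolomorphicForm N (-2 * (r : ℤ)) f c)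
    {z₁ z₂ : ℍ} {d₁ d₂ : ℤ} (h₁ : IsCMPointOfDisc z₁ d₁) (h₂ : IsCMPointOfDisc z₂ d₂)
    (hD : ¬ IsSquare (d₁ * d₂)) :
    ∃ α : ℂ, IsAlgebraic ℚ α ∧ α ≠ 0 ∧
      principalHigherGreen N r c z₁ z₂ =
        |((d₁ * d₂ : ℤ) : ℝ)| ^ (-(r : ℝ) / 2) * Real.log ‖α‖ :=
  h N r hN hr f c hf z₁ z₂ d₁ d₂ h₁ h₂
    fun m _ => not_onHeckeCorrespondence_of_not_isSquare (by positivity) h₁ h₂ hD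

/-! ## `G_s^{Γ₀(N),m}` at CM points as a sum over the integers `n = m cosh d(z₁, γz₂) √(d₁d₂)` -/

/-- **Representation-number form of `G_s^{Γ₀(N),m}(z₁, z₂)` at CM points.** Grouping the terms of
(1.1)–(1.2) of Bruinier–Li–Yang 2025 by the integer `n = m cosh d(z₁, γz₂) √(d₁d₂)`
(`IsCMPointOfDisc.exists_int_eq_cosh_dist_smul`):
`G_s^{Γ₀(N),m}(z₁, z₂) = -2 Σ_{n ∈ ℤ} ρ(n) Q_{s-1}(n/(m√(d₁d₂)))` with
`ρ(n) = #{γ ∈ R_N^{(m)} : m cosh d(z₁, γz₂) √(d₁d₂) = n}` (finite, `.finite_fiber_cosh_dist_smul`),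
for `s ≥ 2`, `m ≥ 1` (absolute convergence, `summable_greenQ_heckeMatrices`). [folklore] -/
theorem IsCMPointOfDisc.higherGreen_eq_tsum_card_mul_greenQ {N : ℕ} {m : ℤ} (hm : 0 < m) {s : ℕ}
    (hs : 2 ≤ s) {z₁ z₂ : ℍ} {d₁ d₂ : ℤ} (h₁ : IsCMPointOfDisc z₁ d₁)
    (h₂ : IsCMPointOfDisc z₂ d₂) :
    higherGreen N s m z₁ z₂ =
      -2 * ∑' n : ℤ, (Nat.card {γ : heckeMatrices N m //
          (m : ℝ) * (Real.cosh (dist z₁ (intGL (γ : Matrix (Fin 2) (Fin 2) ℤ) • z₂)) *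
            Real.sqrt ((d₁ * d₂ : ℤ) : ℝ)) = n} : ℝ) *
        greenQ s ((n : ℝ) / ((m : ℝ) * Real.sqrt ((d₁ * d₂ : ℤ) : ℝ))) := by
  set D : ℝ := Real.sqrt ((d₁ * d₂ : ℤ) : ℝ) with hD
  have hDpos : 0 < D := Real.sqrt_pos.mpr (by exact_mod_cast h₁.mul_disc_pos h₂)
  have hmD : (m : ℝ) * D ≠ 0 := mul_ne_zero (by exact_mod_cast hm.ne') hDpos.ne'
  -- the summands and the integer attached to each `γ`
  set F : heckeMatrices N m → ℝ := fun γ =>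
    greenQ s (Real.cosh (dist z₁ (intGL (γ : Matrix (Fin 2) (Fin 2) ℤ) • z₂))) with hF
  have hν : ∀ γ : heckeMatrices N m, ∃ n : ℤ,
      (m : ℝ) * (Real.cosh (dist z₁ (intGL (γ : Matrix (Fin 2) (Fin 2) ℤ) • z₂)) * D) = n :=
    fun γ => (h₁.exists_int_eq_cosh_dist_smul hm γ.2 h₂).imp fun _ h => h.1
  choose ν hν using hν
  have hsum : Summable F := by
    have h := summable_greenQ_heckeMatrices (N := N) hm hs z₁ z₂
    refine h.congr fun γ => ?_
    rw [hF, one_add_dist_sq_div_eq_cosh_dist]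
  have hfib := hsum.hasSum.tsum_fiberwise ν
  -- on the fibre over `n` the summand is the constant `Q_{s-1}(n/(m√(d₁d₂)))`
  have hconst : ∀ n : ℤ, ∑' γ : ν ⁻¹' {n}, F γ =
      (Nat.card {γ : heckeMatrices N m //
          (m : ℝ) * (Real.cosh (dist z₁ (intGL (γ : Matrix (Fin 2) (Fin 2) ℤ) • z₂)) * D) = n} : ℝ) *
        greenQ s ((n : ℝ) / ((m : ℝ) * D)) := by
    intro n
    have hset : ν ⁻¹' {n} = {γ : heckeMatrices N m |
        (m : ℝ) * (Real.cosh (dist z₁ (intGL (γ : Matrix (Fin 2) (Fin 2) ℤ) • z₂)) * D) = n} := by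
      ext γ
      simp only [Set.mem_preimage, Set.mem_singleton_iff, Set.mem_setOf_eq]
      constructor
      · rintro rfl
        exact hν γ
      · intro h
        exact_mod_cast (hν γ).symm.trans h
    have hval : ∀ γ : ν ⁻¹' {n}, F γ = greenQ s ((n : ℝ) / ((m : ℝ) * D)) := by
      rintro ⟨γ, hγ⟩
      rw [hset, Set.mem_setOf_eq] at hγ
      simp only [hF]
      congr 1
      rw [eq_div_iff hmD]
      linear_combination hγ
    rw [tsum_congr hval, tsum_const, nsmul_eq_mul, hset]
    rfl
  rw [higherGreen_eq_tsum_cosh_dist]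
  congr 1
  simp_rw [← hconst]
  exact hfib.tsum_eq.symm

/-- Each fibre `{γ ∈ R_N^{(m)} : m cosh d(z₁, γz₂) √(d₁d₂) = n}` is finite (indeed
`{γ : cosh d(z₁, γz₂) ≤ B}` is finite for every `B`, by the convergence of
`Σ_γ cosh d(z₁, γz₂)^{-2}`, `summable_inv_pow_coshDistArg`). [folklore] -/
theorem finite_setOf_cosh_dist_smul_le {N : ℕ} {m : ℤ} (hm : 0 < m) (z₁ z₂ : ℍ) (B : ℝ) :
    {γ : heckeMatrices N m |
      Real.cosh (dist z₁ (intGL (γ : Matrix (Fin 2) (Fin 2) ℤ) • z₂)) ≤ B}.Finite := by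
  have hsum := summable_inv_pow_coshDistArg (N := N) hm (le_refl 2) z₁ z₂
  by_cases hB : B < 1
  · convert Set.finite_empty
    ext γ
    simp only [Set.mem_setOf_eq, Set.mem_empty_iff_false, iff_false, not_le]
    exact hB.trans_le (Real.one_le_cosh _)
  · rw [not_lt] at hB
    have hB0 : 0 < B := one_pos.trans_le hB
    have hB2 : (0 : ℝ) < (B ^ 2)⁻¹ := by positivity
    have hev := hsum.tendsto_cofinite_zero.eventually (gt_mem_nhds hB2)
    rw [Filter.eventually_cofinite] at hev
    refine hev.subset fun γ hγ => ?_
    simp only [Set.mem_setOf_eq, not_lt] at hγ ⊢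
    rw [one_add_dist_sq_div_eq_cosh_dist]
    have h1 : 0 < Real.cosh (dist z₁ (intGL (γ : Matrix (Fin 2) (Fin 2) ℤ) • z₂)) :=
      Real.cosh_pos _
    exact inv_anti₀ (by positivity) (pow_le_pow_left₀ h1.le hγ 2)

/-- The fibres of `γ ↦ m cosh d(z₁, γz₂) √(d₁d₂)` on `R_N^{(m)}` are finite, so the
representation numbers `ρ(n)` in `IsCMPointOfDisc.higherGreen_eq_tsum_card_mul_greenQ` are
genuine cardinalities. [folklore] -/
theorem finite_fiber_cosh_dist_smul {N : ℕ} {m : ℤ} (hm : 0 < m) (z₁ z₂ : ℍ) (D : ℝ) (n : ℤ)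
    (hmD : 0 < (m : ℝ) * D) :
    {γ : heckeMatrices N m |
      (m : ℝ) * (Real.cosh (dist z₁ (intGL (γ : Matrix (Fin 2) (Fin 2) ℤ) • z₂)) * D) = n}.Finite := by
  refine (finite_setOf_cosh_dist_smul_le hm z₁ z₂ ((n : ℝ) / ((m : ℝ) * D))).subset fun γ hγ => ?_
  simp only [Set.mem_setOf_eq] at hγ ⊢
  rw [le_div_iff₀ hmD]
  linarith [hγ]

/-- `ρ(n) = 0` for `n < mD`: the fibre of `γ ↦ m cosh d(z₁, γz₂) D` over such `n` is empty since
`cosh ≥ 1` (`D > 0`). [folklore] -/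
theorem card_fiber_cosh_dist_smul_eq_zero {N : ℕ} {m : ℤ} (hm : 0 < m) (z₁ z₂ : ℍ) {D : ℝ}
    (hD : 0 < D) {n : ℤ} (hn : (n : ℝ) < m * D) :
    Nat.card {γ : heckeMatrices N m //
      (m : ℝ) * (Real.cosh (dist z₁ (intGL (γ : Matrix (Fin 2) (Fin 2) ℤ) • z₂)) * D) = n} = 0 := by
  rw [Nat.card_eq_zero]
  left
  refine ⟨fun ⟨γ, hγ⟩ => ?_⟩
  have h1 : 1 ≤ Real.cosh (dist z₁ (intGL (γ : Matrix (Fin 2) (Fin 2) ℤ) • z₂)) := Real.one_le_cosh _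
  have hm0 : (0 : ℝ) < m := by exact_mod_cast hm
  have key : (m : ℝ) * D * 1 ≤
      (m : ℝ) * D * Real.cosh (dist z₁ (intGL (γ : Matrix (Fin 2) (Fin 2) ℤ) • z₂)) :=
    mul_le_mul_of_nonneg_left h1 (by positivity)
  have hre : (m : ℝ) * (Real.cosh (dist z₁ (intGL (γ : Matrix (Fin 2) (Fin 2) ℤ) • z₂)) * D) =
      (m : ℝ) * D * Real.cosh (dist z₁ (intGL (γ : Matrix (Fin 2) (Fin 2) ℤ) • z₂)) := by ring
  linarith

/-- Off `T_m` every argument is `> 1`, so `ρ(n) = 0` also for `n = mD`: the fibre over `n ≤ mD`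
is empty when `(z₁, z₂) ∉ T_m`. [folklore] -/
theorem card_fiber_cosh_dist_smul_eq_zero_of_le {N : ℕ} {m : ℤ} (hm : 0 < m) {z₁ z₂ : ℍ}
    (hT : ¬ OnHeckeCorrespondence N m z₁ z₂) {D : ℝ} (hD : 0 < D) {n : ℤ} (hn : (n : ℝ) ≤ m * D) :
    Nat.card {γ : heckeMatrices N m //
      (m : ℝ) * (Real.cosh (dist z₁ (intGL (γ : Matrix (Fin 2) (Fin 2) ℤ) • z₂)) * D) = n} = 0 := by
  rw [Nat.card_eq_zero]
  left
  refine ⟨fun ⟨γ, hγ⟩ => ?_⟩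
  have hne : intGL (γ : Matrix (Fin 2) (Fin 2) ℤ) • z₂ ≠ z₁ := fun h => hT ⟨γ, γ.2, h⟩
  have h1 : 1 < Real.cosh (dist z₁ (intGL (γ : Matrix (Fin 2) (Fin 2) ℤ) • z₂)) :=
    Real.one_lt_cosh.mpr (dist_ne_zero.mpr hne.symm)
  have hm0 : (0 : ℝ) < m := by exact_mod_cast hm
  have key : (m : ℝ) * D * 1 <
      (m : ℝ) * D * Real.cosh (dist z₁ (intGL (γ : Matrix (Fin 2) (Fin 2) ℤ) • z₂)) :=
    mul_lt_mul_of_pos_left h1 (by positivity)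
  have hre : (m : ℝ) * (Real.cosh (dist z₁ (intGL (γ : Matrix (Fin 2) (Fin 2) ℤ) • z₂)) * D) =
      (m : ℝ) * D * Real.cosh (dist z₁ (intGL (γ : Matrix (Fin 2) (Fin 2) ℤ) • z₂)) := by ring
  linarith

/-! ## The conclusion of Conjecture 1.1 is `ℚ`-linear in `f` -/

/-- `G_{r+1,f}` is additive in the coefficients (finite principal parts). [cite: BruinierLiYang2025, (1.3)] -/
theorem principalHigherGreen_add {N r : ℕ} {c d : ℤ → ℚ}
    (hc : ∃ M : ℕ, ∀ m : ℤ, m < -(M : ℤ) → c m = 0)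
    (hd : ∃ M : ℕ, ∀ m : ℤ, m < -(M : ℤ) → d m = 0) (z₁ z₂ : ℍ) :
    principalHigherGreen N r (c + d) z₁ z₂ =
      principalHigherGreen N r c z₁ z₂ + principalHigherGreen N r d z₁ z₂ := by
  obtain ⟨M, hM⟩ := hc
  obtain ⟨M', hM'⟩ := hd
  have hc' : ∀ m : ℤ, m < -((max M M' : ℕ) : ℤ) → c m = 0 :=
    fun m hm => hM m (lt_of_lt_of_le hm (by simp))
  have hd' : ∀ m : ℤ, m < -((max M M' : ℕ) : ℤ) → d m = 0 :=
    fun m hm => hM' m (lt_of_lt_of_le hm (by simp))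
  have hcd : ∀ m : ℤ, m < -((max M M' : ℕ) : ℤ) → (c + d) m = 0 :=
    fun m hm => by simp [hc' m hm, hd' m hm]
  rw [principalHigherGreen_eq_sum hcd, principalHigherGreen_eq_sum hc',
    principalHigherGreen_eq_sum hd', ← Finset.sum_add_distrib]
  refine Finset.sum_congr rfl fun m _ => ?_
  simp only [Pi.add_apply, Rat.cast_add]
  ring

/-- `G_{r+1,f}` is homogeneous in the coefficients: `G_{r+1,qf} = q G_{r+1,f}` for `q ∈ ℚ`.
[cite: BruinierLiYang2025, (1.3)] -/
theorem principalHigherGreen_smul {N r : ℕ} (q : ℚ) (c : ℤ → ℚ) (z₁ z₂ : ℍ) :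
    principalHigherGreen N r (q • c) z₁ z₂ = (q : ℝ) * principalHigherGreen N r c z₁ z₂ := by
  unfold principalHigherGreen
  rw [← tsum_mul_left]
  refine tsum_congr fun m => ?_
  simp only [Pi.smul_apply, smul_eq_mul, Rat.cast_mul]
  ring

/-- Numbers of the shape `κ log|α|`, `α ∈ ℚ̄ˣ`, are closed under addition (`α ↦ αβ`). [folklore] -/
theorem exists_isAlgebraic_log_norm_add {x y κ : ℝ}
    (hx : ∃ α : ℂ, IsAlgebraic ℚ α ∧ α ≠ 0 ∧ x = κ * Real.log ‖α‖)
    (hy : ∃ α : ℂ, IsAlgebraic ℚ α ∧ α ≠ 0 ∧ y = κ * Real.log ‖α‖) :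
    ∃ α : ℂ, IsAlgebraic ℚ α ∧ α ≠ 0 ∧ x + y = κ * Real.log ‖α‖ := by
  obtain ⟨α, hα, hα0, rfl⟩ := hx
  obtain ⟨β, hβ, hβ0, rfl⟩ := hy
  refine ⟨α * β, hα.mul hβ, mul_ne_zero hα0 hβ0, ?_⟩
  rw [norm_mul, Real.log_mul (norm_ne_zero_iff.mpr hα0) (norm_ne_zero_iff.mpr hβ0)]
  ring

/-- **The conclusion of Conjecture 1.1 at `(z₁, z₂)` is additive in `f`**: if
`G_{r+1,f} = |d₁d₂|^{-r/2} log|α|` and `G_{r+1,g} = |d₁d₂|^{-r/2} log|β|` with `α, β ∈ ℚ̄ˣ`, then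
`G_{r+1,f+g} = |d₁d₂|^{-r/2} log|αβ|` (coefficientwise, finite principal parts). So the rational
forms satisfying the conclusion at a given CM point form a `ℚ`-subspace (with
`gkz_conclusion_smul`), and it suffices to know Conjecture 1.1 on a spanning family of
`M^{!,∞}_{-2r}(Γ₀(N))` with rational coefficients. [cite: BruinierLiYang2025, Conj. 1.1 and (1.3)] -/
theorem gkz_conclusion_add {N r : ℕ} {c d : ℤ → ℚ}
    (hc : ∃ M : ℕ, ∀ m : ℤ, m < -(M : ℤ) → c m = 0)
    (hd : ∃ M : ℕ, ∀ m : ℤ, m < -(M : ℤ) → d m = 0) {z₁ z₂ : ℍ} {d₁ d₂ : ℤ}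
    (h₁ : ∃ α : ℂ, IsAlgebraic ℚ α ∧ α ≠ 0 ∧
      principalHigherGreen N r c z₁ z₂ = |((d₁ * d₂ : ℤ) : ℝ)| ^ (-(r : ℝ) / 2) * Real.log ‖α‖)
    (h₂ : ∃ α : ℂ, IsAlgebraic ℚ α ∧ α ≠ 0 ∧
      principalHigherGreen N r d z₁ z₂ = |((d₁ * d₂ : ℤ) : ℝ)| ^ (-(r : ℝ) / 2) * Real.log ‖α‖) :
    ∃ α : ℂ, IsAlgebraic ℚ α ∧ α ≠ 0 ∧
      principalHigherGreen N r (c + d) z₁ z₂ =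
        |((d₁ * d₂ : ℤ) : ℝ)| ^ (-(r : ℝ) / 2) * Real.log ‖α‖ := by
  rw [principalHigherGreen_add hc hd]
  exact exists_isAlgebraic_log_norm_add h₁ h₂

/-- **The conclusion of Conjecture 1.1 at `(z₁, z₂)` is stable under rational multiples of `f`**
(`α ↦ |α|^q`). [cite: BruinierLiYang2025, Conj. 1.1 and (1.3)] -/
theorem gkz_conclusion_smul {N r : ℕ} (q : ℚ) {c : ℤ → ℚ} {z₁ z₂ : ℍ} {d₁ d₂ : ℤ}
    (h : ∃ α : ℂ, IsAlgebraic ℚ α ∧ α ≠ 0 ∧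
      principalHigherGreen N r c z₁ z₂ = |((d₁ * d₂ : ℤ) : ℝ)| ^ (-(r : ℝ) / 2) * Real.log ‖α‖) :
    ∃ α : ℂ, IsAlgebraic ℚ α ∧ α ≠ 0 ∧
      principalHigherGreen N r (q • c) z₁ z₂ =
        |((d₁ * d₂ : ℤ) : ℝ)| ^ (-(r : ℝ) / 2) * Real.log ‖α‖ := by
  rw [principalHigherGreen_smul]
  exact exists_isAlgebraic_rat_mul_log_norm h q

/-! ## Conversely: `d₁d₂` a perfect square puts `(z₁, z₂)` on a Hecke correspondence -/

/-- **Conversely, CM points `z₁, z₂` with `d₁d₂` a perfect square lie on a Hecke correspondence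
`T_m` of every level `N`** (`m ≥ 1` suitable): `zⱼ = (-bⱼ + i√|dⱼ|)/(2aⱼ)` and
`√|d₁| √|d₂| = |k|` give `z₁ = u + v z₂` with `u, v ∈ ℚ`, `v > 0`, so `z₁ = γ z₂` for the upper
triangular integer matrix `γ = (2a₂²|k|, a₂b₂|k| - a₂b₁|d₂|; 0, 2a₁a₂|d₂|)` of positive
determinant (lower left entry `0`, so `γ ∈ R_N^{(det γ)}` for all `N`). With
`isSquare_mul_disc_of_onHeckeCorrespondence`: **`(z₁, z₂)` lies on some `T_m`, `m ≥ 1`, iff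
`d₁d₂` is a perfect square** (`onHeckeCorrespondence_iff_isSquare`), the dichotomy `E₁ = E₂` /
`E₁ ≠ E₂` of Bruinier–Li–Yang 2025, p. 3. [cite: BruinierLiYang2025, p. 3 and Thm. 1.2] -/
theorem IsCMPointOfDisc.exists_onHeckeCorrespondence_of_isSquare (N : ℕ) {z₁ z₂ : ℍ} {d₁ d₂ : ℤ}
    (h₁ : IsCMPointOfDisc z₁ d₁) (h₂ : IsCMPointOfDisc z₂ d₂) (hD : IsSquare (d₁ * d₂)) :
    ∃ m : ℤ, 0 < m ∧ OnHeckeCorrespondence N m z₁ z₂ := by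
  have hD0 : d₁ * d₂ ≠ 0 := (h₁.mul_disc_pos h₂).ne'
  obtain ⟨k, hk⟩ := hD
  have hk0 : k ≠ 0 := by
    rintro rfl
    exact hD0 (by rw [hk, mul_zero])
  obtain ⟨a₁, b₁, c₁, ha₁, -, hz₁, rfl⟩ := h₁
  obtain ⟨a₂, b₂, c₂, ha₂, -, hz₂, rfl⟩ := h₂
  have hΔ₂ : b₂ ^ 2 - 4 * a₂ * c₂ < 0 := disc_neg_of_quadratic ha₂.ne' hz₂
  have hΔ₁ : b₁ ^ 2 - 4 * a₁ * c₁ < 0 := disc_neg_of_quadratic ha₁.ne' hz₁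
  -- coordinates of the two points
  have hx₁ := re_eq_of_quadratic ha₁.ne' hz₁
  have hx₂ := re_eq_of_quadratic ha₂.ne' hz₂
  have hy₁ := two_mul_im_eq_sqrt_of_quadratic ha₁ hz₁
  have hy₂ := two_mul_im_eq_sqrt_of_quadratic ha₂ hz₂
  set S₁ : ℝ := Real.sqrt (-((b₁ : ℝ) ^ 2 - 4 * a₁ * c₁)) with hS₁
  set S₂ : ℝ := Real.sqrt (-((b₂ : ℝ) ^ 2 - 4 * a₂ * c₂)) with hS₂
  have hS2sq : S₂ ^ 2 = -((b₂ : ℝ) ^ 2 - 4 * a₂ * c₂) :=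
    Real.sq_sqrt (by have : ((b₂ ^ 2 - 4 * a₂ * c₂ : ℤ) : ℝ) < 0 := by exact_mod_cast hΔ₂
                     push_cast at this; linarith)
  have hK : S₁ * S₂ = |(k : ℝ)| := by
    have h0 : (0 : ℝ) ≤ -((b₁ : ℝ) ^ 2 - 4 * a₁ * c₁) := by
      have : ((b₁ ^ 2 - 4 * a₁ * c₁ : ℤ) : ℝ) < 0 := by exact_mod_cast hΔ₁
      push_cast at this; linarith
    rw [hS₁, hS₂, ← Real.sqrt_mul h0, ← Real.sqrt_sq_eq_abs]
    congr 1
    have hk' : (((b₁ ^ 2 - 4 * a₁ * c₁) * (b₂ ^ 2 - 4 * a₂ * c₂) : ℤ) : ℝ) = (k : ℝ) * k := by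
      exact_mod_cast hk
    push_cast at hk'
    linear_combination hk'
  -- the matrix
  set K : ℤ := |k| with hKdef
  set E : ℤ := -(b₂ ^ 2 - 4 * a₂ * c₂) with hE
  have hE0 : 0 < E := by rw [hE]; linarith
  have hK0 : 0 < K := abs_pos.mpr hk0
  set γ : Matrix (Fin 2) (Fin 2) ℤ := !![2 * a₂ ^ 2 * K, a₂ * b₂ * K - a₂ * b₁ * E; 0, 2 * a₁ * a₂ * E]
    with hγ
  set m : ℤ := 2 * a₂ ^ 2 * K * (2 * a₁ * a₂ * E) with hm
  have hm0 : 0 < m := by positivity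
  have hγm : γ ∈ heckeMatrices N m := by
    rw [mem_heckeMatrices, Matrix.det_fin_two, hγ, hm]
    simp
  refine ⟨m, hm0, γ, hγm, ?_⟩
  -- `γ z₂ = z₁`
  apply UpperHalfPlane.ext
  rw [coe_intGL_smul hm0 hγm]
  have hL : ((2 * a₁ * a₂ * E : ℤ) : ℝ) ≠ 0 := by positivity
  have h00 : γ 0 0 = 2 * a₂ ^ 2 * K := by rw [hγ]; rfl
  have h01 : γ 0 1 = a₂ * b₂ * K - a₂ * b₁ * E := by rw [hγ]; rfl
  have h10 : γ 1 0 = 0 := by rw [hγ]; rfl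
  have h11 : γ 1 1 = 2 * a₁ * a₂ * E := by rw [hγ]; rfl
  rw [h00, h01, h10, h11, Int.cast_zero, zero_mul, zero_add]
  have hKcast : ((K : ℤ) : ℝ) = |(k : ℝ)| := by rw [hKdef, Int.cast_abs]
  have ha₁' : (a₁ : ℝ) ≠ 0 := by positivity
  have ha₂' : (a₂ : ℝ) ≠ 0 := by positivity
  apply Complex.ext
  · rw [Complex.div_intCast_re, UpperHalfPlane.coe_re, hx₁]
    simp only [Complex.add_re, Complex.mul_re, Complex.intCast_re, Complex.intCast_im, zero_mul,
      sub_zero, UpperHalfPlane.coe_re, UpperHalfPlane.coe_im, hx₂]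
    push_cast
    field_simp
    ring
  · rw [Complex.div_intCast_im, UpperHalfPlane.coe_im]
    simp only [Complex.add_im, Complex.mul_im, Complex.intCast_re, Complex.intCast_im, zero_mul,
      add_zero, UpperHalfPlane.coe_re, UpperHalfPlane.coe_im]
    -- `2a₂²|k| y₂ = y₁ · 2a₁a₂E`, from `2aⱼyⱼ = Sⱼ`, `S₁S₂ = |k|`, `S₂² = E`
    have hEcast : ((E : ℤ) : ℝ) = S₂ ^ 2 := by rw [hE, hS2sq]; push_cast; ring
    have hL' : 2 * (a₁ : ℝ) * a₂ * S₂ ^ 2 ≠ 0 := by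
      rw [← hEcast]
      positivity
    push_cast
    rw [hEcast, hKcast, div_eq_iff hL']
    linear_combination (-(2 * (a₂ : ℝ) ^ 2 * z₂.im)) * hK + ((a₂ : ℝ) * S₂ * S₁) * hy₂ +
      (-(a₂ : ℝ) * S₂ ^ 2) * hy₁

/-- **`(z₁, z₂)` lies on a Hecke correspondence `T_m`, `m ≥ 1`, iff `d₁d₂` is a perfect square**
(CM points of discriminants `d₁, d₂`; any level `N`): the dichotomy `E₁ = E₂` / `E₁ ≠ E₂` of the
proof of Theorem 1.4 of Bruinier–Li–Yang 2025 in the language of `GKZAlgebraicity`.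
[cite: BruinierLiYang2025, p. 3 and Thm. 1.2] -/
theorem IsCMPointOfDisc.exists_onHeckeCorrespondence_iff_isSquare (N : ℕ) {z₁ z₂ : ℍ} {d₁ d₂ : ℤ}
    (h₁ : IsCMPointOfDisc z₁ d₁) (h₂ : IsCMPointOfDisc z₂ d₂) :
    (∃ m : ℤ, 0 < m ∧ OnHeckeCorrespondence N m z₁ z₂) ↔ IsSquare (d₁ * d₂) :=
  ⟨fun ⟨_, hm, h⟩ => isSquare_mul_disc_of_onHeckeCorrespondence hm h₁ h₂ h,
    h₁.exists_onHeckeCorrespondence_of_isSquare N h₂⟩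

/-! ## Reduction: CM points in the fundamental domain have reduced forms; finiteness -/

section Reduction

open scoped Modular

/-- **A CM point in the standard fundamental domain is the root of a reduced form.** If `z ∈ 𝒟`
(`|Re z| ≤ ½`, `|z| ≥ 1`) is a CM point of discriminant `d`, its primitive form `(a, b, c)`
satisfies `|b| ≤ a ≤ c` (from `Re z = -b/(2a)` and `|z|² = c/a`), hence `3a² ≤ |d|`.
[folklore] -/
theorem IsCMPointOfDisc.exists_reduced_of_mem_fd {z : ℍ} {d : ℤ} (h : IsCMPointOfDisc z d)
    (hz : z ∈ 𝒟) :
    ∃ a b c : ℤ, 0 < a ∧ |b| ≤ a ∧ a ≤ c ∧ 3 * a ^ 2 ≤ -d ∧ Int.gcd (Int.gcd a b) c = 1 ∧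
      (a : ℂ) * (z : ℂ) ^ 2 + b * (z : ℂ) + c = 0 ∧ d = b ^ 2 - 4 * a * c := by
  obtain ⟨a, b, c, ha, hgcd, hq, rfl⟩ := h
  obtain ⟨hx, hy⟩ := re_im_of_quadratic hq
  have hre : |z.re| ≤ 1 / 2 := hz.2
  have hnorm : 1 ≤ Complex.normSq (z : ℂ) := hz.1
  have ha' : (0 : ℝ) < a := by exact_mod_cast ha
  -- `|b| ≤ a`
  have hb : |b| ≤ a := by
    have h1 : (b : ℝ) = -2 * a * z.re := by linarith
    have h2 : |(b : ℝ)| ≤ a := by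
      rw [h1, abs_mul, abs_mul, abs_neg, abs_two, abs_of_pos ha']
      nlinarith [abs_nonneg z.re]
    have h3 : ((|b| : ℤ) : ℝ) ≤ a := by rw [Int.cast_abs]; exact h2
    exact_mod_cast h3
  -- `a ≤ c`, from `a |z|² = c`
  have hc : a ≤ c := by
    have hns : Complex.normSq (z : ℂ) = z.re ^ 2 + z.im ^ 2 := by
      rw [Complex.normSq_apply, UpperHalfPlane.coe_re, UpperHalfPlane.coe_im]; ring
    have key : (a : ℝ) * (z.re ^ 2 + z.im ^ 2) = c := by
      apply mul_left_cancel₀ (show (4 * (a : ℝ)) ≠ 0 by positivity)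
      linear_combination (2 * (a : ℝ) * z.re - b) * hx + hy
    have h1 : (a : ℝ) ≤ c := by
      have : (a : ℝ) * 1 ≤ (a : ℝ) * (z.re ^ 2 + z.im ^ 2) :=
        mul_le_mul_of_nonneg_left (by rw [← hns]; exact hnorm) ha'.le
      linarith
    exact_mod_cast h1
  refine ⟨a, b, c, ha, hb, hc, ?_, hgcd, hq, rfl⟩
  have hb2 : b ^ 2 ≤ a ^ 2 := by
    rw [← sq_abs b]
    exact pow_le_pow_left₀ (abs_nonneg b) hb 2
  nlinarith

/-- **The CM points of discriminant `d` in the fundamental domain `𝒟` lie in an explicit finite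
set**: the roots `(-b + i√|d|)/(2a)` of the forms in the box `1 ≤ a ≤ d² + |d|`,
`|b|, |c| ≤ d² + |d|` (by `IsCMPointOfDisc.exists_reduced_of_mem_fd`: `|b| ≤ a ≤ c`, `3a² ≤ |d|`,
so `a, |b| ≤ |d|` and `0 < c ≤ 4ac = b² + |d| ≤ 2|d|`). [folklore] -/
theorem exists_finset_isCMPointOfDisc_mem_fd (d : ℤ) :
    ∃ S : Finset ℍ, ∀ z : ℍ, z ∈ 𝒟 → IsCMPointOfDisc z d → z ∈ S := by
  classical
  set B : ℤ := d ^ 2 + |d| with hB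
  set box : Finset (ℤ × ℤ × ℤ) := Finset.Icc 1 B ×ˢ (Finset.Icc (-B) B ×ˢ Finset.Icc (-B) B)
    with hbox
  set root : ℤ × ℤ × ℤ → ℍ := fun t =>
    if h : 0 < -((t.2.1 : ℝ) ^ 2 - 4 * t.1 * t.2.2) ∧ (0 : ℝ) < t.1 then
      ⟨⟨-(t.2.1 : ℝ) / (2 * t.1), Real.sqrt (-((t.2.1 : ℝ) ^ 2 - 4 * t.1 * t.2.2)) / (2 * t.1)⟩,
        div_pos (Real.sqrt_pos.mpr h.1) (by linarith [h.2])⟩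
    else UpperHalfPlane.I with hroot
  refine ⟨box.image root, fun z hzD hz => ?_⟩
  obtain ⟨a, b, c, ha, hb, hc, h3, -, hq, hd⟩ := hz.exists_reduced_of_mem_fd hzD
  have hdneg : d < 0 := hz.disc_neg
  rw [Finset.mem_image]
  refine ⟨(a, b, c), ?_, ?_⟩
  · -- `(a, b, c)` lies in the box
    have hd1 : 1 ≤ |d| := Int.one_le_abs hdneg.ne
    have hdabs : |d| = -d := abs_of_neg hdneg
    have hdd : |d| ≤ d ^ 2 := by nlinarith [sq_abs d]
    have ha1 : 1 ≤ a := ha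
    have haa : a ≤ a ^ 2 := by nlinarith
    have ha2 : a ^ 2 ≤ -d := by nlinarith
    have hbabs : |b| ≤ B := by rw [hB]; linarith
    have hb1 : -B ≤ b := by have := neg_abs_le b; linarith
    have hb2 : b ≤ B := (le_abs_self b).trans hbabs
    have hc0 : 0 < c := lt_of_lt_of_le ha hc
    have h4ac : 4 * a * c = b ^ 2 - d := by linarith
    have hbsq : b ^ 2 ≤ a ^ 2 := by
      rw [← sq_abs b]
      exact pow_le_pow_left₀ (abs_nonneg b) hb 2
    have hcB : c ≤ B := by rw [hB]; nlinarith
    have hcB' : -B ≤ c := by rw [hB]; nlinarith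
    have haB : a ≤ B := by rw [hB]; nlinarith
    simp only [hbox, Finset.mem_product, Finset.mem_Icc]
    exact ⟨⟨ha1, haB⟩, ⟨hb1, hb2⟩, ⟨hcB', hcB⟩⟩
  · -- `root (a, b, c) = z`
    have hΔ : 0 < -((b : ℝ) ^ 2 - 4 * a * c) ∧ (0 : ℝ) < a := by
      refine ⟨?_, by exact_mod_cast ha⟩
      have : ((b ^ 2 - 4 * a * c : ℤ) : ℝ) < 0 := by exact_mod_cast (hd ▸ hdneg)
      push_cast at this
      linarith
    have hre := re_eq_of_quadratic ha.ne' hq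
    have him := two_mul_im_eq_sqrt_of_quadratic ha hq
    have ha' : (a : ℝ) ≠ 0 := by positivity
    simp only [hroot, dif_pos hΔ]
    apply UpperHalfPlane.ext
    apply Complex.ext
    · simp only [UpperHalfPlane.coe_re]
      rw [hre]
    · simp only [UpperHalfPlane.coe_im]
      rw [show z.im = Real.sqrt (-((b : ℝ) ^ 2 - 4 * a * c)) / (2 * a) by
        rw [← him]; field_simp]

/-- The CM points of discriminant `d` in the fundamental domain `𝒟` form a finite set. [folklore] -/
theorem finite_setOf_isCMPointOfDisc_mem_fd (d : ℤ) :
    {z : ℍ | z ∈ 𝒟 ∧ IsCMPointOfDisc z d}.Finite := by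
  obtain ⟨S, hS⟩ := exists_finset_isCMPointOfDisc_mem_fd d
  exact S.finite_toSet.subset fun z hz => hS z hz.1 hz.2

/-- **Finiteness of CM points of given discriminant modulo `SL(2, ℤ)`.** For every `d` there is a
finite set `S ⊂ ℍ` such that every CM point of discriminant `d` is `SL(2, ℤ)`-equivalent to a point
of `S` (move the point into `𝒟`, `ModularGroup.exists_smul_mem_fd`; the discriminant is invariant,
`IsCMPointOfDisc.sl_smul`). So the CM points of discriminant `d` on `X₀(1)` — and on every `X₀(N)`,
the index `[SL(2, ℤ) : Γ₀(N)]` being finite — are finite in number (a class number); in Conjecture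
1.1 of Bruinier–Li–Yang 2025, for fixed `(N, r, f, d₁, d₂)` only finitely many values
`G_{r+1,f}(z₁, z₂)` occur (`principalHigherGreen_smul_left/right`). [folklore] -/
theorem exists_finset_isCMPointOfDisc_smul_mem (d : ℤ) :
    ∃ S : Finset ℍ, ∀ z : ℍ, IsCMPointOfDisc z d → ∃ γ : SL(2, ℤ), γ • z ∈ S := by
  obtain ⟨S, hS⟩ := exists_finset_isCMPointOfDisc_mem_fd d
  refine ⟨S, fun z hz => ?_⟩
  obtain ⟨γ, hγ⟩ := ModularGroup.exists_smul_mem_fd z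
  exact ⟨γ, hS _ hγ (hz.sl_smul γ)⟩

/-- **Finiteness of CM points of given discriminant on `X₀(N)`**: for `N ≥ 1` and every `d`
there is a finite `S ⊂ ℍ` such that every CM point of discriminant `d` is `Γ₀(N)`-equivalent to a
point of `S` (from the level-one statement and the finiteness of `[SL(2, ℤ) : Γ₀(N)]`,
Mathlib's `CongruenceSubgroup.instFiniteIndexGamma0`: if `γz ∈ S₀` and `σ` represents the coset
`γΓ₀(N)`, then `δ = σ⁻¹γ ∈ Γ₀(N)` and `δz = σ⁻¹(γz)`). [folklore] -/
theorem exists_finite_isCMPointOfDisc_gamma0_smul_mem (N : ℕ) [NeZero N] (d : ℤ) :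
    ∃ S : Set ℍ, S.Finite ∧ ∀ z : ℍ, IsCMPointOfDisc z d → ∃ δ ∈ Gamma0 N, δ • z ∈ S := by
  obtain ⟨S₀, hS₀⟩ := exists_finset_isCMPointOfDisc_smul_mem d
  haveI : Finite (SL(2, ℤ) ⧸ Gamma0 N) := Subgroup.finite_quotient_of_finiteIndex
  refine ⟨(fun p : (SL(2, ℤ) ⧸ Gamma0 N) × ℍ => p.1.out⁻¹ • p.2) '' (Set.univ ×ˢ (S₀ : Set ℍ)),
    (Set.finite_univ.prod S₀.finite_toSet).image _, fun z hz => ?_⟩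
  obtain ⟨γ, hγ⟩ := hS₀ z hz
  set q : SL(2, ℤ) ⧸ Gamma0 N := (γ : SL(2, ℤ) ⧸ Gamma0 N) with hq
  refine ⟨q.out⁻¹ * γ, QuotientGroup.eq.mp q.out_eq', (q, γ • z), ⟨Set.mem_univ _, hγ⟩, ?_⟩
  simp only [mul_smul]

end Reduction

/-! ## The diagonal: `(z, z) ∈ T_m` iff `m` is a norm from the order of `z` -/

section Diagonal

/-- **The stabiliser of a quadratic irrationality in `R_N^{(m)}`.** Let `z ∈ ℍ` be a root of the
primitive integral form `(a, b, c)` (`a > 0`). An integer matrix `γ ∈ R_N^{(m)}` (`m ≥ 1`) fixes `z`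
iff `γ = p·1 + e·(0, -c; a, b)` with `p² + bpe + ace² = m` and `N ∣ ae`: indeed `γz = z` is the
integral quadratic relation `r z² + (s - p) z - q = 0`, a multiple `e(a, b, c)` of the primitive one
(`exists_eq_mul_of_quadratic_of_primitive`), and `det γ = p(p + be) + ace²` is the norm form of the
order of discriminant `b² - 4ac`. Hence **`(z, z)` lies on the Hecke correspondence `T_m` of
`X₀(N)` iff `m` is represented by `p² + bpe + ace²` with `N ∣ ae`** — the diagonal CM values
excluded by the hypothesis `(z₁, z₂) ∉ Z_f` of Conjecture 1.1 of Bruinier–Li–Yang 2025 are exactly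
those with `c(-m) ≠ 0` for such an `m` (always `m = 1`: `p = 1`, `e = 0`). [folklore] -/
theorem onHeckeCorrespondence_self_iff {N : ℕ} {m : ℤ} (hm : 0 < m) {z : ℍ} {a b c : ℤ}
    (ha : 0 < a) (hgcd : Int.gcd (Int.gcd a b) c = 1)
    (hz : (a : ℂ) * (z : ℂ) ^ 2 + b * (z : ℂ) + c = 0) :
    OnHeckeCorrespondence N m z z ↔
      ∃ p e : ℤ, p ^ 2 + b * p * e + a * c * e ^ 2 = m ∧ (N : ℤ) ∣ a * e := by
  constructor
  · rintro ⟨γ, hγ, hγz⟩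
    have hdet : γ.det ≠ 0 := det_ne_zero_of_mem_heckeMatrices hm.ne' hγ
    -- `γ z = z` as a quadratic relation `r z² + (s - p) z - q = 0`
    have hcoe : ((intGL γ • z : ℍ) : ℂ) = (z : ℂ) := by rw [hγz]
    rw [coe_intGL_smul hm hγ z] at hcoe
    have hden := linear_ne_zero_of_det_ne_zero hdet z
    rw [div_eq_iff hden] at hcoe
    have hq : ((γ 1 0 : ℤ) : ℂ) * (z : ℂ) ^ 2 + ((γ 1 1 - γ 0 0 : ℤ) : ℂ) * (z : ℂ) +
        ((-γ 0 1 : ℤ) : ℂ) = 0 := by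
      push_cast
      linear_combination -hcoe
    obtain ⟨e, h10, h11, h01⟩ := exists_eq_mul_of_quadratic_of_primitive ha.ne' hgcd hz hq
    refine ⟨γ 0 0, e, ?_, ?_⟩
    · have h := (mem_heckeMatrices.mp hγ).1
      rw [Matrix.det_fin_two] at h
      rw [← h, h10, show γ 1 1 = γ 0 0 + e * b by linarith, show γ 0 1 = -(e * c) by linarith]
      ring
    · rw [mul_comm, ← h10]
      exact (mem_heckeMatrices.mp hγ).2
  · rintro ⟨p, e, hpe, hN⟩
    set γ : Matrix (Fin 2) (Fin 2) ℤ := !![p, -(e * c); e * a, p + e * b] with hγdef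
    have hγ : γ ∈ heckeMatrices N m := by
      rw [mem_heckeMatrices, Matrix.det_fin_two, hγdef]
      simp only [Matrix.of_apply, Matrix.cons_val', Matrix.cons_val_zero, Matrix.cons_val_one,
        Matrix.cons_val_fin_one]
      exact ⟨by rw [← hpe]; ring, by rw [mul_comm] at hN; exact hN⟩
    refine ⟨γ, hγ, ?_⟩
    have hdet : γ.det ≠ 0 := det_ne_zero_of_mem_heckeMatrices hm.ne' hγ
    apply UpperHalfPlane.ext
    rw [coe_intGL_smul hm hγ z]
    have hden := linear_ne_zero_of_det_ne_zero hdet z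
    rw [div_eq_iff hden, hγdef]
    simp only [Matrix.of_apply, Matrix.cons_val', Matrix.cons_val_zero, Matrix.cons_val_one,
      Matrix.cons_val_fin_one]
    push_cast
    linear_combination (-(e : ℂ)) * hz

/-- In particular `(z, z) ∈ T_1` always, and **for a CM point `z` of discriminant `d` on `X₀(1)`:
`(z, z) ∈ T_m` iff `m` is a norm `p² + bpe + ace²` from the order of discriminant
`d = b² - 4ac`** (the principal form of discriminant `d` up to equivalence). [folklore] -/
theorem IsCMPointOfDisc.onHeckeCorrespondence_self_iff_levelOne {m : ℤ} (hm : 0 < m) {z : ℍ} {d : ℤ}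
    (h : IsCMPointOfDisc z d) :
    OnHeckeCorrespondence 1 m z z ↔
      ∃ a b c p e : ℤ, 0 < a ∧ (a : ℂ) * (z : ℂ) ^ 2 + b * (z : ℂ) + c = 0 ∧ d = b ^ 2 - 4 * a * c ∧
        p ^ 2 + b * p * e + a * c * e ^ 2 = m := by
  obtain ⟨a, b, c, ha, hgcd, hz, hd⟩ := h
  rw [onHeckeCorrespondence_self_iff hm ha hgcd hz]
  constructor
  · rintro ⟨p, e, hpe, -⟩
    exact ⟨a, b, c, p, e, ha, hz, hd, hpe⟩
  · rintro ⟨a', b', c', p, e, ha', hz', hd', hpe⟩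
    -- the two forms agree up to an integer factor `f` with `f² = 1`
    obtain ⟨f, rfl, rfl, rfl⟩ := exists_eq_mul_of_quadratic_of_primitive ha.ne' hgcd hz hz'
    have hf : f = 1 := by
      have hf2 : f ^ 2 * (b ^ 2 - 4 * a * c) = b ^ 2 - 4 * a * c := by
        rw [hd] at hd'
        linear_combination -hd'
      have hdne : b ^ 2 - 4 * a * c ≠ 0 := by
        have := disc_neg_of_quadratic ha.ne' hz
        exact this.ne
      have hf21 : f ^ 2 = 1 := by
        have := mul_right_cancel₀ hdne (hf2.trans (one_mul _).symm)
        exact this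
      have hfpos : 0 < f := by
        by_contra hle
        push Not at hle
        have : f * a ≤ 0 := mul_nonpos_of_nonpos_of_nonneg hle ha.le
        linarith
      nlinarith
    subst hf
    refine ⟨p, e, by simpa using hpe, by simp⟩

end Diagonal

end Literature.NumberTheory.Automorphic
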